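import Summits.RiemannHypothesis.RiemannHypothesis.Theorems.TiltedLandingLaw421R3RateChildCountC
import Summits.RiemannHypothesis.RiemannHypothesis.Theorems.TiltedLandingLaw421R3RateChildCountF

/-!
# R1u SPLIT (lens-2 g5, O5-c) — the untouched half of `IsolatedLowChildLawJ` is the TREE's R1a′ᴶ / R1a′ᴹ; the TOUCHED half is the residual

Custody note for ⟨33346⟩ `TiltedLandingLaw421R`, route EarlyAppointments, RATE residual R1u (image of record `lens2/UncoveredR1u-v2.lean`
b46eb6b2cc40d550, law `RhW08.ChildCount.IsolatedLowChildLawJ`).  Everything here is sorry-free; the two laws typed below are OPEN.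

* `LowChildAt f j v` — R1u's conclusion at `(j, v)` VERBATIM (a moving upper child `w` strictly below `v` inside the closed Jensen disc of an
  upper zero `z` at least as tall as `v` whose disc meets `v`'s).
* `lowChildAt_of_disc` — (K) a moving upper child in `v`'s OWN closed disc is strictly below `v` (take `z := v`; `‖w − Re v‖ ≤ Im v` and
  `w ≠ v` force `Im w < Im v`).  This is the only geometry the untouched case needs.
* `SepCornerLowChildLawJ` — (LAW, OPEN, codimension ≥ 1) the SEPARATED case of R1u OUTSIDE the two landed cells: every strictly taller zero is
  disc-separated from `v`, and NOT (low-clear ∧ (simple ∨ clean feet)).  This is exactly the residual already booked for `stub_childExistsSep`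
  (the L2ᴶ low-clear method binder + the corner «`v` multiple AND a foot degenerate»), read with R1u's weaker conclusion.
* `TouchedLowChildLawJ` — (LAW, OPEN — THE R1u RESIDUAL PROPER) the TOUCHED case: some strictly taller zero `z` has `|Re v − Re z| ≤ Im v + Im z`.
* ★ `sepLowChild_of_tree` — (K) separated + low-clear + (simple ∨ clean feet) ⇒ `LowChildAt`, from the TREE theorems
  `farChildExistsLawSepSimpleJ_holds` (#1161 …C) and `farChildExistsLawSepMultJ_holds` (#1167 …F).
* ★★ `isolatedLowChild_of_split : TouchedLowChildLawJ → SepCornerLowChildLawJ → <IsolatedLowChildLawJ's text>` — the conclusion is R1u's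
  statement written out, so once `…R3RateUncoveredR1u` lands the glue `IsolatedLowChildLawJ` is `fun hT hC => isolatedLowChild_of_split hT hC`.

What is NOT here (honest): no proof of `TouchedLowChildLawJ`.  The cluster count W1 (`lens2/ClusterCount-v2.lean`) gives, for an atomic touching
pair with clean feet, EXACTLY TWO moving upper children in `D̄_v ∪ D̄_z` and each child in one of the two discs (`child_mem_disc`), but not WHICH disc
nor a height comparison with `Im v`; the intended extra input is the Jensen SIGN AT THE POINT `v` (uncovered ⇔ `Im (1/(v−z) + 1/(v−z̄)) ≤ 0`,
so the far field at `v` points down and the Newton child of `v` sits below `v` to first order) made rigorous through the tree's Newton door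
(`…R3NewtonNumbers`) — not done.  Nothing here bears on the truth of RH; RH is not proved; R1u / ★A / 33346 / 33347 OPEN; checked ≠ landed ≠ proved.
-/

open Complex Metric Set
open scoped Real ComplexConjugate

namespace RhW08.UncoveredSplit

open RhW08.ChildCount RhW08.Lens1PinningIso

/-- R1u's CONCLUSION at `(j, v)`, verbatim from `IsolatedLowChildLawJ`: a moving upper child `w` of `f^{(j+1)}` strictly below `v`, inside the
closed Jensen disc of an upper zero `z` of `f^{(j)}` with `Im v ≤ Im z` whose disc meets `v`'s. -/
def LowChildAt (f : ℂ → ℂ) (j : ℕ) (v : ℂ) : Prop :=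
  ∃ w z : ℂ, iteratedDeriv (j + 1) f w = 0 ∧ iteratedDeriv j f w ≠ 0 ∧ 0 < w.im ∧ w.im < v.im ∧
    iteratedDeriv j f z = 0 ∧ 0 < z.im ∧ v.im ≤ z.im ∧ |z.re - v.re| ≤ z.im + v.im ∧ ‖w - (z.re : ℂ)‖ ≤ z.im

/-- (K) A point of the closed disc `‖w − Re v‖ ≤ Im v` other than `v` itself lies STRICTLY below `v`. -/
theorem im_lt_of_mem_disc_ne {v w : ℂ} (hdisc : ‖w - (v.re : ℂ)‖ ≤ v.im) (hne : w ≠ v) : w.im < v.im := by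
  have him : (w - (v.re : ℂ)).im = w.im := by simp
  have hre : (w - (v.re : ℂ)).re = w.re - v.re := by simp
  have hle : w.im ≤ v.im := by
    have h := Complex.abs_im_le_norm (w - (v.re : ℂ))
    rw [him] at h
    exact (le_abs_self _).trans (h.trans hdisc)
  rcases hle.lt_or_eq with h | h
  · exact h
  · exfalso
    apply hne
    have hn0 : 0 ≤ ‖w - (v.re : ℂ)‖ := norm_nonneg _
    have hsq : ‖w - (v.re : ℂ)‖ ^ 2 ≤ v.im ^ 2 := pow_le_pow_left₀ hn0 hdisc 2
    rw [Complex.sq_norm, Complex.normSq_apply, hre, him, h] at hsq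
    have hre0 : (w.re - v.re) * (w.re - v.re) ≤ 0 := by nlinarith
    have hre1 : w.re - v.re = 0 := by nlinarith [mul_self_nonneg (w.re - v.re)]
    apply Complex.ext
    · simpa [sub_eq_zero] using hre1
    · exact h

/-- (K) THE UNTOUCHED GEOMETRY: a moving upper child `w` in `v`'s own closed Jensen disc (`‖w − Re v‖ ≤ |Im v|`, the R1a′ conclusion) witnesses
`LowChildAt f j v` with `z := v`. -/
theorem lowChildAt_of_disc {f : ℂ → ℂ} {j : ℕ} {v w : ℂ} (hv : iteratedDeriv j f v = 0) (hvim : 0 < v.im)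
    (hw0 : iteratedDeriv (j + 1) f w = 0) (hGw : iteratedDeriv j f w ≠ 0) (hwim : 0 < w.im)
    (hdisc : ‖w - (v.re : ℂ)‖ ≤ |v.im|) : LowChildAt f j v := by
  rw [abs_of_pos hvim] at hdisc
  have hne : w ≠ v := fun h => hGw (h ▸ hv)
  refine ⟨w, v, hw0, hGw, hwim, im_lt_of_mem_disc_ne hdisc hne, hv, hvim, le_rfl, ?_, hdisc⟩
  simp only [sub_self, abs_zero]
  linarith

open RhIdea6.G17.W07C7 RhIdea6.G17.W07C7.Rev6 RhIdea6.G18.W07C8.Law421BirthS RhIdea6.G19.W07C11.Seam RhIdea6.G20.W07C12.Frac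
  RhIdea6.G20.W07C12.StColP RhW07.C12.FieldSplit RhW08.Round1 RhW08.StSwap RhW08.Round2 RhW08.QuadW RhW08.SealSwapQ in
open RhW08.SealSwap (PBot) in
/-- (LAW R1uˢ-corner, OPEN) The SEPARATED case of R1u outside the two landed cells: `v` R/2-laterally isolated, every strictly taller zero
disc-separated from `v`, and NOT (low-clear ∧ (simple ∨ clean feet)).  Its content is the residual already booked for `stub_childExistsSep`
(L2ᴶ low-clearness beyond the strip; the corner «`v` multiple with a degenerate foot»), here with R1u's weaker conclusion `LowChildAt`. -/
def SepCornerLowChildLawJ : Prop :=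
  ∀ (η : ℝ) (f : ℂ → ℂ) (x₀ s hmax R Hs : ℝ) (B : ℕ), EngineHyps5 2 η f x₀ s hmax R Hs B →
    ∀ (j : ℕ) (v : ℂ), Charged (PTrkSQ PBot) StTrkDQ ReadyR2 η f x₀ s hmax R Hs B j →
      IsLowest StTrkDQ η f x₀ s hmax R Hs B j v →
      (∀ z : ℂ, iteratedDeriv j f z = 0 → |z.re - v.re| < R / 2 → z = v ∨ z = conj v) →
      (∀ z : ℂ, iteratedDeriv j f z = 0 → v.im < z.im → v.im + z.im < |v.re - z.re|) →
      ¬ ((∀ z : ℂ, iteratedDeriv j f z = 0 → 0 < z.im → z.im ≤ v.im → z ≠ v → v.im + z.im < |v.re - z.re|) ∧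
          (iteratedDeriv (j + 1) f v ≠ 0 ∨ CleanFeet f j v)) →
      LowChildAt f j v

open RhIdea6.G17.W07C7 RhIdea6.G17.W07C7.Rev6 RhIdea6.G18.W07C8.Law421BirthS RhIdea6.G19.W07C11.Seam RhIdea6.G20.W07C12.Frac
  RhIdea6.G20.W07C12.StColP RhW07.C12.FieldSplit RhW08.Round1 RhW08.StSwap RhW08.Round2 RhW08.QuadW RhW08.SealSwapQ in
open RhW08.SealSwap (PBot) in
/-- (LAW R1uᵀ, OPEN — THE R1u RESIDUAL PROPER) The TOUCHED case of R1u: `v` the lowest band state of a charged level, R/2-laterally isolated,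
and SOME strictly taller zero `z` of `f^{(j)}` has its closed Jensen disc meeting `v`'s (`|Re v − Re z| ≤ Im v + Im z`); conclusion `LowChildAt`.
Why it might fail: a touching configuration where both moving children of the pair sit at height ≥ `Im v` (excluded to first order by the Jensen
sign at `v` when `v` is uncovered — `uncovered_of_lateral_isolation` — but not proved at finite `κ·Im v`). -/
def TouchedLowChildLawJ : Prop :=
  ∀ (η : ℝ) (f : ℂ → ℂ) (x₀ s hmax R Hs : ℝ) (B : ℕ), EngineHyps5 2 η f x₀ s hmax R Hs B →
    ∀ (j : ℕ) (v : ℂ), Charged (PTrkSQ PBot) StTrkDQ ReadyR2 η f x₀ s hmax R Hs B j →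
      IsLowest StTrkDQ η f x₀ s hmax R Hs B j v →
      (∀ z : ℂ, iteratedDeriv j f z = 0 → |z.re - v.re| < R / 2 → z = v ∨ z = conj v) →
      (∃ z : ℂ, iteratedDeriv j f z = 0 ∧ v.im < z.im ∧ |v.re - z.re| ≤ v.im + z.im) →
      LowChildAt f j v

open RhIdea6.G17.W07C7 RhIdea6.G17.W07C7.Rev6 RhIdea6.G18.W07C8.Law421BirthS RhIdea6.G19.W07C11.Seam RhIdea6.G20.W07C12.Frac
  RhIdea6.G20.W07C12.StColP RhW07.C12.FieldSplit RhW08.Round1 RhW08.StSwap RhW08.Round2 RhW08.QuadW RhW08.SealSwapQ in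
open RhW08.SealSwap (PBot) in
/-- ★ (K) THE UNTOUCHED HALF IS TREE: separated + low-clear + (simple ∨ clean feet) ⇒ `LowChildAt`, by `farChildExistsLawSepSimpleJ_holds`
(R1a′ᴶ, `…R3RateChildCountC`) resp. `farChildExistsLawSepMultJ_holds` (R1a′ᴹ, `…R3RateChildCountF`) and `lowChildAt_of_disc`. -/
theorem sepLowChild_of_tree {η : ℝ} {f : ℂ → ℂ} {x₀ s hmax R Hs : ℝ} {B : ℕ} (hE : EngineHyps5 2 η f x₀ s hmax R Hs B)
    {j : ℕ} {v : ℂ} (hC : Charged (PTrkSQ PBot) StTrkDQ ReadyR2 η f x₀ s hmax R Hs B j)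
    (hlow : IsLowest StTrkDQ η f x₀ s hmax R Hs B j v)
    (hiso : ∀ z : ℂ, iteratedDeriv j f z = 0 → |z.re - v.re| < R / 2 → z = v ∨ z = conj v)
    (hsep : ∀ z : ℂ, iteratedDeriv j f z = 0 → v.im < z.im → v.im + z.im < |v.re - z.re|)
    (hlc : ∀ z : ℂ, iteratedDeriv j f z = 0 → 0 < z.im → z.im ≤ v.im → z ≠ v → v.im + z.im < |v.re - z.re|)
    (hcell : iteratedDeriv (j + 1) f v ≠ 0 ∨ CleanFeet f j v) : LowChildAt f j v := by
  have hv : iteratedDeriv j f v = 0 := hlow.1.2.1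
  have hvim : 0 < v.im := hlow.1.2.2.1
  rcases hcell with hsimp | hclean
  · obtain ⟨w, hw0, hGw, hwim, hdisc⟩ :=
      farChildExistsLawSepSimpleJ_holds η f x₀ s hmax R Hs B hE j v hC hlow hiso hsep hsimp hlc
    exact lowChildAt_of_disc hv hvim hw0 hGw hwim hdisc
  · obtain ⟨w, hw0, hGw, hwim, hdisc⟩ :=
      farChildExistsLawSepMultJ_holds η f x₀ s hmax R Hs B hE j v hC hlow hiso hsep hlc hclean
    exact lowChildAt_of_disc hv hvim hw0 hGw hwim hdisc

open RhIdea6.G17.W07C7 RhIdea6.G17.W07C7.Rev6 RhIdea6.G18.W07C8.Law421BirthS RhIdea6.G19.W07C11.Seam RhIdea6.G20.W07C12.Frac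
  RhIdea6.G20.W07C12.StColP RhW07.C12.FieldSplit RhW08.Round1 RhW08.StSwap RhW08.Round2 RhW08.QuadW RhW08.SealSwapQ in
open RhW08.SealSwap (PBot) in
/-- ★★ (K) THE SPLIT OF R1u.  The conclusion is `IsolatedLowChildLawJ` (image `lens2/UncoveredR1u-v2.lean`) WRITTEN OUT, so that once
`…R3RateUncoveredR1u` lands, `IsolatedLowChildLawJ` follows from the two OPEN laws by `fun hT hC => isolatedLowChild_of_split hT hC`:
R1u = (TOUCHED residual `TouchedLowChildLawJ`) + (separated corner `SepCornerLowChildLawJ`) + TREE. -/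
theorem isolatedLowChild_of_split (hT : TouchedLowChildLawJ) (hK : SepCornerLowChildLawJ) :
    ∀ (η : ℝ) (f : ℂ → ℂ) (x₀ s hmax R Hs : ℝ) (B : ℕ), EngineHyps5 2 η f x₀ s hmax R Hs B →
      ∀ (j : ℕ) (v : ℂ), Charged (PTrkSQ PBot) StTrkDQ ReadyR2 η f x₀ s hmax R Hs B j →
        IsLowest StTrkDQ η f x₀ s hmax R Hs B j v →
        (∀ z : ℂ, iteratedDeriv j f z = 0 → |z.re - v.re| < R / 2 → z = v ∨ z = conj v) →
        ∃ w z : ℂ, iteratedDeriv (j + 1) f w = 0 ∧ iteratedDeriv j f w ≠ 0 ∧ 0 < w.im ∧ w.im < v.im ∧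
          iteratedDeriv j f z = 0 ∧ 0 < z.im ∧ v.im ≤ z.im ∧ |z.re - v.re| ≤ z.im + v.im ∧ ‖w - (z.re : ℂ)‖ ≤ z.im := by
  intro η f x₀ s hmax R Hs B hE j v hC hlow hiso
  by_cases hsep : ∀ z : ℂ, iteratedDeriv j f z = 0 → v.im < z.im → v.im + z.im < |v.re - z.re|
  · by_cases hcell : (∀ z : ℂ, iteratedDeriv j f z = 0 → 0 < z.im → z.im ≤ v.im → z ≠ v → v.im + z.im < |v.re - z.re|) ∧
        (iteratedDeriv (j + 1) f v ≠ 0 ∨ CleanFeet f j v)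
    · exact sepLowChild_of_tree hE hC hlow hiso hsep hcell.1 hcell.2
    · exact hK η f x₀ s hmax R Hs B hE j v hC hlow hiso hsep hcell
  · push Not at hsep
    obtain ⟨z, hz, hvz, htouch⟩ := hsep
    exact hT η f x₀ s hmax R Hs B hE j v hC hlow hiso ⟨z, hz, hvz, htouch⟩

end RhW08.UncoveredSplit
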